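import Summits.Ventures.HodgeRepro.QuadFinset12
import Summits.Ventures.HodgeRepro.Level3Witness

/-!
# Degrees 10 and 14: every single-class `SumTwo` quadruple has a conjugate pair — kernel rows

Blind re-derivation cell `pub-hodge-repro`, seat `p1` (gen 6).  Typer's `QuadRows8.lean` /
`QuadRows12.lean` / `QuadFinset12.lean` record, by kernel `decide` on the engine check
`noSingleClassSumTwo`, that for every `(G, c)` of degrees 6, 8, 12 no `SumTwo` quadruple of CM types
without a conjugate pair is single-class; `SingleClass16Witness.lean` shows the sentence fails in
degree 16.  The two degrees in between are closed here: the groups of order 10 and 14 are `C₁₀`, `D₅`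
and `C₁₄`, `D₇`, and the dihedral groups of odd index have NO central involution
(`complexConjs_D5_eq_empty`, `complexConjs_D7_eq_empty`), so `(C₁₀, 5)` and `(C₁₄, 7)` are the only
pairs (`C₁₀` and `cc_C10` are typer's, `Level3Witness.lean`) — and the check passes on both tables
(`noSingleClassSumTwo_C10`, `noSingleClassSumTwo_C14`).
Hence «no single-class `SumTwo` quadruple without a conjugate pair» holds for EVERY `(G, c)` with
`|G| ≤ 14` (kernel: typer for 6, 8, 12; this file for 10, 14; p4-g4 independently for 6–12) and
first fails at `|G| = 16`.  Python control: `proofs/p1-g6/singleclass16.out` (orders 6–14: 0).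
-/

set_option autoImplicit false

open Summit.Ventures.HodgeRepro.FaceCensus
open scoped Pointwise

namespace HodgeRepro

/-! `C10`, `cc_C10`, `cc_C10_isComplexConj` are typer's (`Level3Witness.lean`): the cyclic group of
order `10` with its unique involution `5`. -/

/-- `C₁₀ ≃ Fin 10`. -/
def encC10 : C10 ≃ Fin 10 := Multiplicative.toAdd

/-- The engine table of `(C₁₀, 5)`. -/
def tableC10 : CMGaloisType 10 := tableOf encC10 cc_C10

/-- The cyclic group of order `14`, multiplicatively. -/
abbrev C14 := Multiplicative (ZMod 14)

/-- The complex conjugation `7` of `C₁₄` (its unique involution). -/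
def cc_C14 : C14 := Multiplicative.ofAdd 7

/-- `cc_C14` is a complex conjugation (`decide`). -/
theorem cc_C14_isComplexConj : IsComplexConj cc_C14 := by decide

/-- `C₁₄ ≃ Fin 14`. -/
def encC14 : C14 ≃ Fin 14 := Multiplicative.toAdd

/-- The engine table of `(C₁₄, 7)`. -/
def tableC14 : CMGaloisType 14 := tableOf encC14 cc_C14

/-- The dihedral group `D₅` (order 10) has no central involution: no `(D₅, c)` exists. -/
theorem complexConjs_D5_eq_empty : complexConjs (DihedralGroup 5) = ∅ := by decide

/-- The dihedral group `D₇` (order 14) has no central involution: no `(D₇, c)` exists. -/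
theorem complexConjs_D7_eq_empty : complexConjs (DihedralGroup 7) = ∅ := by decide

namespace QuadEngine

/-- `C₁₀`: the check passes (kernel `decide`, `32` CM types × `10²` pairs of twists). -/
theorem noSingleClassSumTwo_C10 : noSingleClassSumTwo tableC10 = true := by decide +kernel

/-- `C₁₄`: the check passes (kernel `decide`, `128` CM types × `14²` pairs of twists). -/
theorem noSingleClassSumTwo_C14 : noSingleClassSumTwo tableC14 = true := by decide +kernel

end QuadEngine

/-- **`C₁₀`**: no `SumTwo` quadruple of CM types without a conjugate pair is single-class
(`SingleClass.lean`'s vocabulary, through typer's transfer `not_isSingleClass_of_check`). -/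
theorem not_isSingleClass_C10 (T : Fin 4 → Finset C10) (hT : IsCMType cc_C10 (T 0)) (hs : SumTwo T)
    (hnc : ∀ i j : Fin 4, T j ≠ cc_C10 • T i) : ¬ IsSingleClass T :=
  QuadEngine.not_isSingleClass_of_check encC10 cc_C10_isComplexConj
    QuadEngine.noSingleClassSumTwo_C10 T hT hs hnc

/-- **`C₁₄`**: no `SumTwo` quadruple of CM types without a conjugate pair is single-class. -/
theorem not_isSingleClass_C14 (T : Fin 4 → Finset C14) (hT : IsCMType cc_C14 (T 0)) (hs : SumTwo T)
    (hnc : ∀ i j : Fin 4, T j ≠ cc_C14 • T i) : ¬ IsSingleClass T :=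
  QuadEngine.not_isSingleClass_of_check encC14 cc_C14_isComplexConj
    QuadEngine.noSingleClassSumTwo_C14 T hT hs hnc

end HodgeRepro
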